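import Summits.Langlands.Langlands.Theses.ExteriorSquareAscent
import Literature.NumberTheory.GaloisRepresentations.ResidualGaloisRep
import Literature.NumberTheory.GaloisRepresentations.WeilDeligneGeneric
import Literature.NumberTheory.LFunctions.ChebotarevDensity
import HarnessLib

/-!
# Sketch — crux-ideate r1 k2 for `ExteriorSquareAscent.RestOfReciprocity` (stmt-Langlands-18056)

Idea card `irreducible-system-unlocks-monodromy`: the route's target `X = IrreducibleGL4`
(all-`ℓ` irreducibility of semisimple avatars in the rank-4 non-essentially-self-dual sector)
is exactly the standing hypothesis under which the printed lifting-based monodromy theorems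
run.  Two checkable statements of the line, typed over existing declarations (not proved):

* `residualIrreducibility_cofinite_of_irreducibleGL4` — FIRST LEMMA: X ⇒ for a regular
  algebraic cuspidal `π` on `GL₄` over a CM / totally real `K` outside the essentially-self-dual
  and quadratically-self-twisted loci, every semisimple C-Satake-compatible
  `ρ : Γ_K → GL₄(ℚ̄_ℓ)` is residually absolutely irreducible after restriction to `K(ζ_ℓ)`,
  for ALL BUT FINITELY MANY `ℓ` (X makes the HLTT system irreducible at EVERY `λ`; regularity
  + non-self-duality make it Lie-irreducible of TYPE A₃ — `G^der = SL₄` — at every `λ`;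
  Hui, arXiv:2208.04004 Thm. 2.10 (iv)–(v), fed with the strict-compatibility inputs of
  A'Campo–Hevesi–Thorne–Whitmore arXiv:2607.11763 Thm. 1.2.1 and Varma, does the rest;
  the density-one form is already Barnet-Lamb–Gee–Geraghty–Taylor Prop. 5.2.2/5.3.2).
* `genericMonodromy_positiveDensity_of_irreducibleGL4` — the REGION the line delivers:
  X ⇒ `EisensteinMonodromy.GenericMonodromy` restricted to (`n = 4`, weight gaps `≥ 4`,
  non-essentially-self-dual `π`) for `ℓ` in a set of POSITIVE Dirichlet density
  (Matsumoto arXiv:2312.01551 Thm. 6.12 + Prop. 6.18 + Prop. 2.20; genericity of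
  `WD(ρ|_v)^{F-ss}` ⟺ `N_Gal = N_aut` given Varma's `≺`).
-/

noncomputable section

open scoped NumberField Classical
open Filter IsDedekindDomain NumberField
open Literature.NumberTheory.Automorphic Literature.NumberTheory.GaloisRepresentations
open Literature.NumberTheory.LFunctions
open Summit.Langlands.Langlands.Theses.ExteriorSquareAscent (IrreducibleGL4)

namespace Summit.Langlands.Langlands.Cruxes.RestOfReciprocity.IrreducibleSystemUnlocksMonodromy

/-- **First lemma (stub 1 of the line).**  X ⇒ residual absolute irreducibility over `K(ζ_ℓ)`
for ALL BUT FINITELY MANY `ℓ`, in X's own C-normalisation (`arithFrobPolyOfSatake ι q 4`):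
for `K` totally real or CM, `π` regular algebraic cuspidal on `GL₄(𝔸_K)` with a Hecke field,
NOT essentially self-dual and NOT quadratically self-twisted at Satake level, there is a finite
set `S` of rational primes such that for every prime `ℓ ∉ S`, every `ι`, every semisimple
`ρ : Γ_K → GL₄(ℚ̄_ℓ)` that is C-Satake–Frobenius compatible with `(π, ι)` a.e., and every model
`L'` of `K(ζ_ℓ)`, the restriction `ρ|_{Γ_{L'}}` is residually absolutely irreducible.
Proof line: `IrreducibleGL4` gives irreducibility of `ρ` at EVERY `ℓ`; regularity makes an
irreducible non-induced `ρ` Lie-irreducible (Patrikis), non-self-duality forces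
`G^{der} = SL₄` (type A₃); the HLTT representations form a Serre compatible system with bounded
tame inertia weights and potential semistability (A'Campo–Hevesi–Thorne–Whitmore Thm. 1.2.1 +
Fontaine–Laffaille; Varma Thm. 1); Hui's algebraic-envelope theorem (arXiv:2208.04004
Thm. 2.10 (iv)–(v)) then gives irreducibility of the residual representation on `Γ_{K^{ab}}`,
hence on `Γ_{K(ζ_ℓ)}`, for almost all `λ`.  [cite: Hui2208.04004, Thm. 2.10] -/
theorem residualIrreducibility_cofinite_of_irreducibleGL4 (hX : IrreducibleGL4) :
    ∀ (K : Type) [Field K] [NumberField K], IsTotallyReal K ∨ NumberField.IsCMField K →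
    ∀ (h1 : isCompact_glFiniteIntegralLevel 1 K) (hcpt : isCompact_glFiniteIntegralLevel 4 K)
      (π : CuspidalAutomorphicRepData 4 K hcpt), π.1.IsRegularAlgebraic →
      (∃ E : Subfield ℂ, FiniteDimensional ℚ E ∧ ∀ᶠ v in cofinite, ∀ α : Multiset ℂ,
          π.1.HasSatakeParamAt v α → ∀ i ≤ 4,
            ((((Real.sqrt (v.residueCard : ℝ)) : ℝ) : ℂ) ^ (i * (4 - i))) * α.esymm i ∈ E) →
      ¬ (∃ η : CuspidalAutomorphicRepData 1 K h1, ∀ᶠ v in cofinite, ∀ α : Multiset ℂ,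
          π.1.HasSatakeParamAt v α → ∃ e : ℂ, η.1.HasSatakeParamAt v {e} ∧
            α.map (fun a => a⁻¹) = α.map (fun a => e * a)) →
      ¬ (∃ (L' : Type) (_ : Field L') (_ : NumberField L') (_ : Algebra K L'),
          Module.finrank K L' = 2 ∧ ∀ᶠ v : HeightOneSpectrum (𝓞 K) in cofinite, ∀ α : Multiset ℂ,
            π.1.HasSatakeParamAt v α → α.map (fun a => (if ∃ w : HeightOneSpectrum (𝓞 L'),
              w.asIdeal.under (𝓞 K) = v.asIdeal ∧ w.asIdeal.inertiaDeg (𝓞 K) = 1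
              then (1 : ℂ) else -1) * a) = α) →
      ∃ S : Finset ℕ, ∀ ℓ ∉ S, ∀ [Fact ℓ.Prime] (ι : PadicAlgCl ℓ ≃+* ℂ)
        (ρ : FramedGaloisRep K (PadicAlgCl ℓ) 4),
          ρ.toGaloisRep.IsSemisimple →
          (∀ᶠ v : HeightOneSpectrum (𝓞 K) in cofinite, ∃ α : Multiset ℂ,
              π.1.HasSatakeParamAt v α ∧ ρ.IsUnramifiedAt v ∧
                ρ.HasFrobCharpolyAt v (arithFrobPolyOfSatake ι v.residueCard 4 α)) →
          ∀ (L' : Type) [Field L'] [Algebra K L'] [IsCyclotomicExtension {ℓ} K L'],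
            (ρ.restrictField L').IsResiduallyAbsIrreducible := by
  sorry

/-- **The region the line delivers** (junction with `EisensteinMonodromy.GenericMonodromy`,
`n = 4`): X ⇒ for `K` totally real or CM, `π` regular algebraic cuspidal on `GL₄(𝔸_K)` of
infinity type `T` with a-exponent gaps `≥ 4` at every embedding (Matsumoto's weight condition
`λ_{τ,i} − λ_{τ,i+1} ≥ n − 1 = 3`), with a Hecke field, not essentially self-dual at Satake
level: there is a set `L₀` of primes of POSITIVE Dirichlet density such that for every `ℓ ∈ L₀`,
`ι`, every semisimple C-compatible `ρ` and every `v ∤ ℓ`, the Weil–Deligne representation of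
`ρ|_{Γ_{K_v}}` is GENERIC (⟺ `N_Gal = N_aut`, given Varma's `≺` and the uniqueness of the
generic parameter with prescribed semisimplification).
Proof line: first lemma + Matsumoto Thm. 6.12 (positive-density `L₀ ⊆ L`) + his Prop. 2.20.
[cite: Matsumoto2312.01551, Thm. 6.12 and Prop. 2.20] -/
theorem genericMonodromy_positiveDensity_of_irreducibleGL4 (hX : IrreducibleGL4) :
    ∀ (K : Type) [Field K] [NumberField K], IsTotallyReal K ∨ NumberField.IsCMField K →
    ∀ (h1 : isCompact_glFiniteIntegralLevel 1 K) (hcpt : isCompact_glFiniteIntegralLevel 4 K)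
      (π : CuspidalAutomorphicRepData 4 K hcpt) (T : InfinityType K 4),
      π.1.HasInfinityType T → T.IsRegularAlgebraic →
      (∀ σ : K →+* ℂ, ∀ p ∈ T σ, ∀ q ∈ T σ, p.a ≠ q.a → (4 : ℝ) ≤ ‖p.a - q.a‖) →
      (∃ E : Subfield ℂ, FiniteDimensional ℚ E ∧ ∀ᶠ v in cofinite, ∀ α : Multiset ℂ,
          π.1.HasSatakeParamAt v α → ∀ i ≤ 4,
            ((((Real.sqrt (v.residueCard : ℝ)) : ℝ) : ℂ) ^ (i * (4 - i))) * α.esymm i ∈ E) →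
      ¬ (∃ η : CuspidalAutomorphicRepData 1 K h1, ∀ᶠ v in cofinite, ∀ α : Multiset ℂ,
          π.1.HasSatakeParamAt v α → ∃ e : ℂ, η.1.HasSatakeParamAt v {e} ∧
            α.map (fun a => a⁻¹) = α.map (fun a => e * a)) →
      ∃ L₀ : Set ℕ, (∃ d : ℝ, 0 < d ∧ HasDirichletDensity L₀ d) ∧
        ∀ ℓ ∈ L₀, ∀ [Fact ℓ.Prime] (ι : PadicAlgCl ℓ ≃+* ℂ) (ρ : FramedGaloisRep K (PadicAlgCl ℓ) 4),
          ρ.toGaloisRep.IsSemisimple →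
          (∀ᶠ v : HeightOneSpectrum (𝓞 K) in cofinite, ∃ α : Multiset ℂ,
              π.1.HasSatakeParamAt v α ∧ ρ.IsUnramifiedAt v ∧
                ρ.HasFrobCharpolyAt v (arithFrobPolyOfSatake ι v.residueCard 4 α)) →
          ∀ v : HeightOneSpectrum (𝓞 K), ((ℓ : ℕ) : 𝓞 K) ∉ v.asIdeal →
            ∃ W : WeilDeligneRep (v.adicCompletion K) (PadicAlgCl ℓ) (Fin 4 → PadicAlgCl ℓ),
              IsWeilDeligneOfLadic (ρ.toLocal v).toWeilGroupHom W ∧ W.IsGeneric := by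
  sorry

end Summit.Langlands.Langlands.Cruxes.RestOfReciprocity.IrreducibleSystemUnlocksMonodromy

end
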